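import Summits.HodgeConjecture.HodgeConjecture.Theorems.MarkmanPartnerTransportPicardThreeK3SquaresRMSpread
import Summits.HodgeConjecture.HodgeConjecture.Theorems.BoundaryReadoutPullbackAlgebraic
import Literature.AlgebraicGeometry.HodgeTheory.InvariantClassesFromTotalSpaceHolds
import Literature.AlgebraicGeometry.HodgeTheory.SmoothBlowupHodgeConjecture
import Literature.AlgebraicGeometry.HilbertScheme.HilbertSquareBlowupDiagonal

/-!
# Route MarkmanPartnerTransport · the Hodge conjecture for HILBERT SQUARES `S^{[2]}` of K3 surfaces with real
# multiplication carried by a spread family (line «maximal-family spread» reaches the `ρ(X) ≤ 3` regime)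

The crux `LowPicardRealMultiplication` (item #5, stmt-HodgeConjecture-19653) names as model counterexample
candidate the Hilbert square `X = S^{[2]}` of a projective K3 surface `S` of Picard rank `2` with real
multiplication (`ρ(X) = 3`, no partner, no isometries beyond `±1`; tree fact
`VanGeemenSchuett2025_exists_rmK3_realQuadratic_picardTwo`). The spread-family reduction of the K3-square
real-multiplication third (`RMSpreadFamily`, files `…RMSpreadDefs` / `…PicardThreeK3SquaresRMSpread`) has NO
Picard-rank hypothesis, and `HC⁴(S × S) ⇒ HC⁴(S^{[2]})` is a theorem of the tree modulo Beauville–Fogarty's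
double cover (gen 6's `hodgeConjectureFor_hilbertSquare_of_square`: one smooth blow-up step + surjective descent,
`hodgeConjectureFor_of_tower_surjective_le_five`; re-derived inline here from route-independent modules so that
this file stays out of every Theses cone). Composing:

* `hodgeConjectureFor_hilbertSquare_of_rmSpreadFamily` — for a smooth projective surface `S`, `t` rational,
  killing `N¹H²(S)`, generating the rational Hodge endomorphisms of `T(S)`, and a spread family for `(S, t)`:
  the Hodge conjecture holds for EVERY Hilbert square `H` of `S` (`IsHilbertSchemeOfPoints 2 S H Ξ`, `H` smooth
  projective of dimension `4`), modulo `Beauville1983_hilbertSquare_blowupDiagonal_surjection` ONLY (Voisin II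
  Thm. 4.18 being the tree's `deligne1968_invariantClass_fromTotalSpace_holds`);
* `hodgeConjectureFor_hilbertSquare_of_isRealMultiplicationK3_of_spreadFamilies` — for a K3 surface with
  real multiplication by `ℚ[X]/(P)` of ANY Picard rank (`IsRealMultiplicationK3 S ρ P`, van Geemen–Schütt
  §2.1) all of whose generators admit spread families, `HC⁴(H)` for every Hilbert square `H` of `S` — in
  particular at `ρ = 2`, i.e. inside the regime of item #5, for the K3 surfaces of the RM component through
  van Geemen–Schütt's MAXIMAL family Thm. 1.1 (11) (`ℚ(ζ₁₁+ζ₁₁⁻¹)`, `ρ = 2`, `Pic = U`, 2 moduli) once the two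
  geometric inputs (I1′) universal RM-component family with flat generator, (I2) its dominance, are supplied.

CONDITIONAL (credit nothing): one named fact (the double cover) + the displayed spread-family input. No
definition, no sorry. Prover seat hodge-nonav-19652-p1 (gen 7), `--supports stmt-HodgeConjecture-19652`.
Nothing here proves HC, the crux, or item #5.

References: van Geemen–Schütt, Forum Math. Sigma 13 (2025) e2, Thm. 1.1 (11), §3.4, §4.8, §5.8; A. Beauville,
J. Differential Geom. 18 (1983) §6; Voisin, *Hodge Theory II* (2003), Thm. 4.18, §7.3.2; Varesco, Math. Z.
305 (2023) §2.
-/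

noncomputable section

set_option linter.dupNamespace false

open Module CategoryTheory MonoidalCategory Polynomial
open Literature.AlgebraicTopology.SingularHomology
open Literature.AlgebraicGeometry Literature.AlgebraicGeometry.Motives Literature.AlgebraicGeometry.HodgeTheory
open Literature.AlgebraicGeometry.Surfaces
open Literature.AlgebraicGeometry.HilbertScheme
open Summit.HodgeConjecture.HodgeConjecture.Theorems.MarkmanPartnerTransport

namespace Summit.HodgeConjecture.HodgeConjecture.Theorems.MarkmanPartnerTransport.PartnerLattice

variable {S H : SchemeOver ℂ} {Ξ : (S ⊗ H).left.IdealSheafData}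

/-- **HC⁴ for the Hilbert square of a surface whose transcendental generator is carried by a spread
family.** `S` smooth projective surface; `t` a rational endomorphism of `H²(S(ℂ); ℂ)` killing `N¹H²(S)` with
`TranscendentalEndomorphismsGeneratedBy S t`; `F : RMSpreadFamily S hS t` (a smooth projective family through
`S ⊗ S` over a smooth irreducible quasi-projective base, the generator as a flat section, a dominant
cycle-carrying classifying morphism). Then every Hilbert square `H` of `S` satisfies `HodgeConjectureFor 4 H`:
`RMSpreadFamily.hodgeConjectureFor_square` (Voisin II Thm. 4.18 supplied by the tree's
`deligne1968_invariantClass_fromTotalSpace_holds`) and `hodgeConjectureFor_hilbertSquare_of_square`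
(blow up the diagonal, descend along the double cover). No Picard-rank hypothesis.
[cite: Beauville1983, §6 (e)–(f), p. 766] [cite: VoisinHodgeII2003, Thm. 4.18 and §7.3.2]
[cite: Varesco2023, §2 (p. 8)] -/
theorem hodgeConjectureFor_hilbertSquare_of_rmSpreadFamily
    (hρ : Beauville1983_hilbertSquare_blowupDiagonal_surjection) (hS : IsSmoothProjective 2 S)
    (hHilb : IsHilbertSchemeOfPoints 2 S H Ξ) (hH : IsSmoothProjective 4 H)
    {t : complexBetti S (2 * 1) →ₗ[ℂ] complexBetti S (2 * 1)}
    (ht_rat : ∀ y, IsRationalClass y → IsRationalClass (t y))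
    (ht_N : ∀ d ∈ algebraicClasses S 1, t d = 0)
    (hgen : TranscendentalEndomorphismsGeneratedBy S t) (F : RMSpreadFamily S hS t) :
    HodgeConjectureFor 4 H := by
  -- `HC⁴(S × S) ⇒ HC⁴(S^{[2]})`: blow up the diagonal, descend along the surjection (as in gen 6's
  -- `hodgeConjectureFor_hilbertSquare_of_square`, re-derived here from route-independent modules)
  obtain ⟨B, b, ρ, hBl, hρs⟩ := hρ S hS H Ξ hHilb
  haveI := hρs
  exact hodgeConjectureFor_of_tower_surjective_le_five fulton1998_map_mem_algebraicClasses_holds (n := 4)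
    (by norm_num) (Relation.ReflTransGen.single (hBl.smoothBlowupStep (by norm_num))) hBl.top hH ρ
    (F.hodgeConjectureFor_square deligne1968_invariantClass_fromTotalSpace_holds ht_rat ht_N hgen)

/-- **HC⁴ for the Hilbert squares of an RM K3 surface all of whose generators admit spread families** — ANY
Picard rank, in particular `ρ(S) = 2` (`ρ(S^{[2]}) = 3`: the regime of item #5 `LowPicardRealMultiplication`,
whose model counterexample candidates are exactly such Hilbert squares): `IsRealMultiplicationK3 S ρ P`
(K3, Picard number `ρ`, not CM, a rational Hodge endomorphism `t` killing `N¹` with image `⊥ N¹`, `P(t) = 0`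
on `T`, generating `End_Hdg(T)`) + a spread family for every such `t` ⇒ `HodgeConjectureFor 4 H` for every
Hilbert square `H` of `S`, modulo the double-cover fact only. With (I1′) + (I2) for van Geemen–Schütt's maximal
family Thm. 1.1 (11) (`ℚ(ζ₁₁+ζ₁₁⁻¹)`, `ρ = 2`) this covers the Hilbert squares over that whole RM component.
[cite: GeemenSchutt2023, Thm. 1.1 (11), §3.4, §4.8 and §5.8] [cite: Beauville1983, §6 (e)–(f), p. 766]
[cite: VoisinHodgeII2003, Thm. 4.18 and §7.3.2] -/
theorem hodgeConjectureFor_hilbertSquare_of_isRealMultiplicationK3_of_spreadFamilies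
    (hρ : Beauville1983_hilbertSquare_blowupDiagonal_surjection) {ρ : ℕ} {P : ℚ[X]}
    (h : IsRealMultiplicationK3 S ρ P) (hHilb : IsHilbertSchemeOfPoints 2 S H Ξ) (hH : IsSmoothProjective 4 H)
    (hF : ∀ t : complexBetti S (2 * 1) →ₗ[ℂ] complexBetti S (2 * 1),
      (∀ y, IsRationalClass y → IsRationalClass (t y)) →
      (∀ (i j : ℕ) (y : complexBetti S (2 * 1)),
        IsOfHodgeType 2 S (2 * 1) i j y → IsOfHodgeType 2 S (2 * 1) i j (t y)) →
      (∀ d ∈ algebraicClasses S 1, t d = 0) →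
      (∀ (y : complexBetti S (2 * 1)), ∀ d ∈ algebraicClasses S 1,
        cupProduct (rfl : 2 * 1 + 2 * 1 = 2 * 2) (t y) d = 0) →
      IsAnnihilatedOnTranscendentalBy S t P → TranscendentalEndomorphismsGeneratedBy S t →
      Nonempty (RMSpreadFamily S h.isK3Surface.isSmoothProjective t)) :
    HodgeConjectureFor 4 H := by
  obtain ⟨B, b, ρ', hBl, hρs⟩ := hρ S h.isK3Surface.isSmoothProjective H Ξ hHilb
  haveI := hρs
  exact hodgeConjectureFor_of_tower_surjective_le_five fulton1998_map_mem_algebraicClasses_holds (n := 4)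
    (by norm_num) (Relation.ReflTransGen.single (hBl.smoothBlowupStep (by norm_num))) hBl.top hH ρ'
    (hodgeConjectureFor_square_of_isRealMultiplicationK3_of_spreadFamilies
      deligne1968_invariantClass_fromTotalSpace_holds h hF)

end Summit.HodgeConjecture.HodgeConjecture.Theorems.MarkmanPartnerTransport.PartnerLattice
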